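/-
Copyright (c) 2026. All rights reserved.
Released under Apache 2.0 license as described in the file LICENSE.
Authors: HodgeCM publication cell (pub-hodgecm), DAG-node prover lineage #14 (gen 6: statements and proofs;
gen 7: tree port).
-/
import Literature.Analysis.Distribution.SchwartzFlowSmooth
import HarnessLib

/-!
# Complex-scalar difference quotients `((s : ℂ))⁻¹ • (ω(s)Φ - Φ)` of flows on Schwartz space

Topic `Analysis/Distribution`; namespace `Literature.Analysis.Distribution`.  Smooth-vector statements for a
representation `ω` on a COMPLEX Fréchet space are naturally written with the complex scalar
`((s : ℝ) : ℂ)⁻¹` in front of the difference `ω(s) v - v`, `s → 0`, `s ≠ 0`, whereas the Schwartz-space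
derivative theorems of `SchwartzLinearFlowDeriv`, `SchwartzTranslationFlowDeriv`, `SchwartzFlowSmooth` are
written with the real scalar `s⁻¹`.  On any complex vector space with a compatible real structure the two
expressions are EQUAL (`ofReal_inv_smul_eq`, an instance of Mathlib's `algebraMap_smul`), so the two kinds of
statement are interchangeable (`tendsto_ofReal_inv_smul_iff`).  This file records the complex-scalar forms
of the principal derivative theorems, for `ℂ`-normed targets `F`
(`[NormedSpace ℂ F] [IsScalarTower ℝ ℂ F] [SMulCommClass ℝ ℂ F]`, e.g. `F = ℂ`):

* `tendsto_smul_compCLM_sub_div_ofReal`, `tendsto_smul_compCLM_sub_div_at_ofReal` — weighted linear flows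
  `c s • (Φ ∘ L s)` (`c : ℝ → ℂ`), at `0` and at every base point;
* `tendsto_compSubConstCLM_sub_div_ofReal`, `tendsto_compSubConstCLM_smul_sub_div_at_ofReal` — translation
  flows;
* `tendsto_expWeight_dilation_sub_div_ofReal_at` (+ `'`) — the modulus-twisted dilation group
  `s ↦ e^{κ s} Φ(e^s ·)` viewed with complex scalars (`κ : ℝ`; the `|det|^{1/2}`-type unitary
  normalisation on `𝓢(ℝ^d)` is `κ = d/2`), generator `κ + x·∇` — the one-parameter group of a hyperbolic
  Levi element `diag(e^s, e^{-s})` in a Schrödinger model (G. B. Folland, *Harmonic Analysis in Phase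
  Space*, Ch. 4 [Folland1989]; M. Reed, B. Simon, *Methods of Modern Mathematical Physics I*, §V.3
  [ReedSimonI1980]).

Design: pure bookkeeping over the real-scalar theorems; no new analysis.  NOT here: anything specific to a
particular representation.

Provenance: tree port (LEAN-IN-TREE, 2026-08-18) of the HodgeCM publication cell's package file
`HodgeCM/Automorphic/SchwartzOfRealSlope.lean` (unit `pub-hodgecm-pv14-g6`, gate run 31; namespace
`HodgeCM.SchwartzWeil` ↦ `Literature.Analysis.Distribution`, statements verbatim; the two scalar identities
re-proved through `algebraMap_smul`).  Nothing in this file is specific to that cell or under adjudication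
there.
-/

set_option autoImplicit false

noncomputable section

open Filter Topology
open scoped SchwartzMap LineDeriv

namespace Literature.Analysis.Distribution

/-! ## The scalar identity -/

section Scalar

variable {M : Type*} [AddCommGroup M] [Module ℂ M] [Module ℝ M] [IsScalarTower ℝ ℂ M]

/-- On a complex vector space with compatible real structure, `((s : ℂ))⁻¹ • v = s⁻¹ • v`. [folklore] -/
theorem ofReal_inv_smul_eq (s : ℝ) (v : M) : ((s : ℂ))⁻¹ • v = s⁻¹ • v := by
  rw [← Complex.ofReal_inv]
  exact algebraMap_smul ℂ s⁻¹ v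

/-- `((s : ℂ)) • v = s • v`. [folklore] -/
theorem ofReal_smul_eq (s : ℝ) (v : M) : ((s : ℂ)) • v = s • v :=
  algebraMap_smul ℂ s v

variable [TopologicalSpace M]

/-- The complex-scalar and the real-scalar difference quotients have the same limits. [folklore] -/
theorem tendsto_ofReal_inv_smul_iff {u : ℝ → M} {l : Filter ℝ} {y : M} :
    Tendsto (fun s : ℝ => ((s : ℂ))⁻¹ • u s) l (𝓝 y) ↔ Tendsto (fun s : ℝ => s⁻¹ • u s) l (𝓝 y) := by
  simp only [ofReal_inv_smul_eq]

end Scalar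

/-! ## Complex-scalar forms of the Schwartz-space derivative theorems -/

section Schwartz

variable {E F : Type*} [NormedAddCommGroup E] [NormedSpace ℝ E] [NormedAddCommGroup F]
  [NormedSpace ℝ F] [NormedSpace ℂ F] [IsScalarTower ℝ ℂ F] [SMulCommClass ℝ ℂ F]
variable {c : ℝ → ℂ} {κ : ℂ} {L : ℝ → E ≃L[ℝ] E} {A : E →L[ℝ] E}

/-- **Weighted linear flows, complex scalars**:
`((s : ℂ))⁻¹ • (c s • (Φ ∘ L s) - Φ) → κ • Φ + flowGen A Φ` in `𝓢(E, F)`. [folklore] -/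
theorem tendsto_smul_compCLM_sub_div_ofReal (hc0 : c 0 = 1) (hc : HasDerivAt c κ 0)
    (hL0 : ((L 0 : E ≃L[ℝ] E) : E →L[ℝ] E) = 1)
    (hL : HasDerivAt (fun s => ((L s : E ≃L[ℝ] E) : E →L[ℝ] E)) A 0) (Φ : 𝓢(E, F)) :
    Tendsto (fun s : ℝ => ((s : ℂ))⁻¹
        • (c s • SchwartzMap.compCLMOfContinuousLinearEquiv ℂ (L s) Φ - Φ))
      (𝓝[≠] 0) (𝓝 (κ • Φ + flowGen A Φ)) :=
  tendsto_ofReal_inv_smul_iff.2 (tendsto_smul_compCLM_sub_div ℂ hc0 hc hL0 hL Φ)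

/-- **Weighted linear flows at every base point, complex scalars** (`c` multiplicative, `L` a group):
with `Ψ = c s₀ • (Φ ∘ L s₀)`, `((s : ℂ))⁻¹ • (c (s₀+s) • (Φ ∘ L (s₀+s)) - Ψ) → κ • Ψ + flowGen A Ψ`. [folklore] -/
theorem tendsto_smul_compCLM_sub_div_at_ofReal (hc0 : c 0 = 1) (hc : HasDerivAt c κ 0)
    (hcmul : ∀ s t, c (s + t) = c s * c t)
    (hL0 : ((L 0 : E ≃L[ℝ] E) : E →L[ℝ] E) = 1)
    (hL : HasDerivAt (fun s => ((L s : E ≃L[ℝ] E) : E →L[ℝ] E)) A 0)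
    (hmul : ∀ s t x, L (s + t) x = L s (L t x)) (Φ : 𝓢(E, F)) (s₀ : ℝ) :
    Tendsto (fun s : ℝ => ((s : ℂ))⁻¹
        • (c (s₀ + s) • SchwartzMap.compCLMOfContinuousLinearEquiv ℂ (L (s₀ + s)) Φ
          - c s₀ • SchwartzMap.compCLMOfContinuousLinearEquiv ℂ (L s₀) Φ)) (𝓝[≠] 0)
      (𝓝 (κ • (c s₀ • SchwartzMap.compCLMOfContinuousLinearEquiv ℂ (L s₀) Φ)
        + flowGen A (c s₀ • SchwartzMap.compCLMOfContinuousLinearEquiv ℂ (L s₀) Φ))) :=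
  tendsto_ofReal_inv_smul_iff.2 (tendsto_smul_compCLM_sub_div_at ℂ hc0 hc hcmul hL0 hL hmul Φ s₀)

/-- **Translation flows, complex scalars**: for a curve `v` in `E` with `v 0 = 0`, `v'(0) = a`,
`((s : ℂ))⁻¹ • (Φ(· - v s) - Φ) → -∂_{a} Φ` in `𝓢(E, F)`. [folklore] -/
theorem tendsto_compSubConstCLM_sub_div_ofReal {v : ℝ → E} {a : E} (hv0 : v 0 = 0)
    (hv : HasDerivAt v a 0) (Φ : 𝓢(E, F)) :
    Tendsto (fun s : ℝ => ((s : ℂ))⁻¹ • (SchwartzMap.compSubConstCLM ℂ (v s) Φ - Φ)) (𝓝[≠] 0)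
      (𝓝 (-(∂_{a} Φ))) :=
  tendsto_ofReal_inv_smul_iff.2 (tendsto_compSubConstCLM_sub_div ℂ hv0 hv Φ)

/-- **Straight translation flows at every base point, complex scalars**:
`((s : ℂ))⁻¹ • (Φ(· - (s₀+s)a) - Φ(· - s₀ a)) → -∂_{a} (Φ(· - s₀ a))`. [folklore] -/
theorem tendsto_compSubConstCLM_smul_sub_div_at_ofReal (a : E) (Φ : 𝓢(E, F)) (s₀ : ℝ) :
    Tendsto (fun s : ℝ => ((s : ℂ))⁻¹ • (SchwartzMap.compSubConstCLM ℂ ((s₀ + s) • a) Φ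
        - SchwartzMap.compSubConstCLM ℂ (s₀ • a) Φ)) (𝓝[≠] 0)
      (𝓝 (-(∂_{a} (SchwartzMap.compSubConstCLM ℂ (s₀ • a) Φ)))) :=
  tendsto_ofReal_inv_smul_iff.2 (tendsto_compSubConstCLM_smul_sub_div_at' ℂ a Φ s₀)

/-- The modulus-type cocycle `s ↦ (e^{κ s} : ℂ)` (`κ : ℝ`): value `1` at `0`. [folklore] -/
theorem ofReal_expWeight_zero (κ : ℝ) : ((Real.exp (κ * 0) : ℝ) : ℂ) = 1 := by simp

/-- Its derivative at `0` is `κ`. [folklore] -/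
theorem hasDerivAt_ofReal_expWeight (κ : ℝ) :
    HasDerivAt (fun s : ℝ => ((Real.exp (κ * s) : ℝ) : ℂ)) (κ : ℂ) 0 :=
  (hasDerivAt_expWeight κ).ofReal_comp

/-- It is multiplicative. [folklore] -/
theorem ofReal_expWeight_add (κ s t : ℝ) :
    ((Real.exp (κ * (s + t)) : ℝ) : ℂ) = ((Real.exp (κ * s) : ℝ) : ℂ) * ((Real.exp (κ * t) : ℝ) : ℂ) := by
  rw [expWeight_add, Complex.ofReal_mul]

/-- **The modulus-twisted dilation group with complex scalars, at every base point**: with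
`Ψ = e^{κ s₀} Φ(e^{s₀} ·)` (`κ : ℝ`, the weight acting through `ℂ`),
`((s : ℂ))⁻¹ • (e^{κ(s₀+s)} Φ(e^{s₀+s} ·) - Ψ) → κ • Ψ + (x·∇) Ψ` in `𝓢(E, F)`.  This is the shape of
the one-parameter group of a hyperbolic Levi element `diag(e^s, e^{-s})` in a Schrödinger model
(`κ = (dim)/2` for the unitary normalisation). [folklore] -/
theorem tendsto_expWeight_dilation_sub_div_ofReal_at (κ : ℝ) (Φ : 𝓢(E, F)) (s₀ : ℝ) :
    Tendsto (fun s : ℝ => ((s : ℂ))⁻¹ • (((Real.exp (κ * (s₀ + s)) : ℝ) : ℂ)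
        • SchwartzMap.compCLMOfContinuousLinearEquiv ℂ (dilation E (s₀ + s)) Φ
        - ((Real.exp (κ * s₀) : ℝ) : ℂ) • SchwartzMap.compCLMOfContinuousLinearEquiv ℂ (dilation E s₀) Φ))
      (𝓝[≠] 0)
      (𝓝 ((κ : ℂ) • (((Real.exp (κ * s₀) : ℝ) : ℂ)
          • SchwartzMap.compCLMOfContinuousLinearEquiv ℂ (dilation E s₀) Φ)
        + flowGen (1 : E →L[ℝ] E)
          (((Real.exp (κ * s₀) : ℝ) : ℂ) • SchwartzMap.compCLMOfContinuousLinearEquiv ℂ (dilation E s₀) Φ))) :=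
  tendsto_smul_compCLM_sub_div_at_ofReal (c := fun s : ℝ => ((Real.exp (κ * s) : ℝ) : ℂ)) (κ := (κ : ℂ))
    (ofReal_expWeight_zero κ) (hasDerivAt_ofReal_expWeight κ) (ofReal_expWeight_add κ)
    (coe_dilation_zero E) (hasDerivAt_coe_dilation E) (dilation_add_apply E) Φ s₀

/-- The same with the weights written as REAL scalars on the `ℂ`-Schwartz space (the two actions
agree: `ofReal_smul_eq`). [folklore] -/
theorem tendsto_expWeight_dilation_sub_div_ofReal_at' (κ : ℝ) (Φ : 𝓢(E, F)) (s₀ : ℝ) :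
    Tendsto (fun s : ℝ => ((s : ℂ))⁻¹ • (Real.exp (κ * (s₀ + s))
        • SchwartzMap.compCLMOfContinuousLinearEquiv ℂ (dilation E (s₀ + s)) Φ
        - Real.exp (κ * s₀) • SchwartzMap.compCLMOfContinuousLinearEquiv ℂ (dilation E s₀) Φ))
      (𝓝[≠] 0)
      (𝓝 (κ • (Real.exp (κ * s₀) • SchwartzMap.compCLMOfContinuousLinearEquiv ℂ (dilation E s₀) Φ)
        + flowGen (1 : E →L[ℝ] E)
          (Real.exp (κ * s₀) • SchwartzMap.compCLMOfContinuousLinearEquiv ℂ (dilation E s₀) Φ))) := by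
  have h := tendsto_expWeight_dilation_sub_div_ofReal_at (E := E) (F := F) κ Φ s₀
  simp only [ofReal_smul_eq] at h
  exact h

end Schwartz

end Literature.Analysis.Distribution
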